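/-
Copyright (c) 2026 the pub-hodgecm-mathlib formalisation cell (harness21).  Seat hodgecm-mathlib-F0P3a-p01 (g38), explicit-unit SUPPORTS-ONLY on
h413 = `stmt-HodgeConjecture-24833` (Track A «(D-RAM) FOUR-FRAME» ∕ strike line L3 `stub_N6nsDyadic`; heir LEAD rules 57 ∕ 69).  2026-09-04.
-/
import Literature.NumberTheory.Rogawski1990.LocalTransferIdentityCoreDyadicDescent      -- ★ p849813: `n6nsDyadic_of_dyadicAntidiag` («DYADIC» ⟸ «DYADIC AT `Φ₃`»); brings ★ p847938 `N6nsDyadicStatement`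
import Literature.NumberTheory.Rogawski1990.ShalikaGermExpansionUnitaryThreeNonsplitCM   -- ★ p850317: `UnitaryGroup.shalikaGermExpansionNonsplit_antidiagOne_three` (organ (D-SH), every non-split place)
import Literature.NumberTheory.Rogawski1990.LocalTransferIdentityCoreThreeWaySplit       -- ★ `ramificationIdx'_ne_one_of_not_isUnramifiedIn_of_subsingleton`
import Literature.NumberTheory.Automorphic.UnitaryGroupNonsplitPlace                      -- ★ `UnitaryGroup.PlacesOver.subsingleton_of_smul_eq`
import Summits.HodgeConjecture.HodgeConjecture.Theorems.F0P3cDyUnramCore                  -- ★ organ (D-UNR) twin `dyUnramCore` (LH4-p01 (g12))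
import Summits.HodgeConjecture.HodgeConjecture.Theorems.F0P3cDyRamCoreOfLetters           -- ★ p862417 (this seat): organ (D-RAM) hypothesis-form twin `dyRamCore_of_cleanSgn_of_cleanSgn₂ (hβ) (hβ₂)`
import HarnessLib

/-!
# H413 · strike line L3 `stub_N6nsDyadic` — THE HYPOTHESIS-FORM `Theorems` TWIN OF THE DYADIC LEAF'S PAID HEAD:
# `n6nsDyadic_of_cleanSgn_of_cleanSgn₂ (hβ) (hβ₂) : Literature.NumberTheory.Rogawski1990.N6nsDyadicStatement`

Crux H413 = `stmt-HodgeConjecture-24833`; route `HCCMUnconditional`; cell `pub/hodgecm-mathlib`.  The closer∕aggregator `Cruxes/H413/Lines/F0_U3LettersRung1.lean`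
(registry `stmt-HodgeConjecture-27456`) carries the registered print row `stub_N6nsDyadic : Literature.NumberTheory.Rogawski1990.N6nsDyadicStatement` ([Rogawski1990 §4.9
Prop. 4.9.1 (a)] local `Δ‴_v`-transfer at the identity at the DYADIC non-split places).  The dyadic leaf `Cruxes/H413/Lines/F0_P3c_DyadicPaydown.lean` ED. 4 proves the head
`n6nsDyadic_of_organs : (D-SH) → (D-UNR) → (D-RAM) → N6nsDyadicStatement` and pays (D-SH) (★ p850317) and (D-UNR) (★ `F0P3cDyUnramCore.dyUnramCore`); its one open organ is
(D-RAM) `stub_DyRamCore`, whose hypothesis-form `Theorems` twin from EXACTLY the two open tier-0 letters (β) `stub_law_cleanSgn`, (β₂) `stub_law_cleanSgn₂` of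
`Cruxes/H413/Lines/F0_P3c_DyRamFourFrame.lean` ED. 9 is ★ p862417 `F0P3cDyRamCoreOfLetters.dyRamCore_of_cleanSgn_of_cleanSgn₂`.

WHAT THIS FILE PROVES (no open goal, axioms = the trio; THEOREMS ONLY — no `def`, no `instance`, no notation, no named-fact hypothesis; imports = ★ `Literature` + two ★
`Theorems` modules + `HarnessLib`, NO `Cruxes/**` module):
* `n6nsDyadic_of_dyRamCore (hram : ‹organ text of `stub_DyRamCore` VERBATIM›) : N6nsDyadicStatement` — the leaf's head `n6nsDyadic_of_organs` with (D-SH) and (D-UNR)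
  DISCHARGED by their ★ names (proof = the leaf's, verbatim: ★ `n6nsDyadic_of_dyadicAntidiag`, `Subsingleton (PlacesOver L v)` from `c • w = w`, the inert ∕ ramified
  dichotomy via ★ `ramificationIdx'_ne_one_of_not_isUnramifiedIn_of_subsingleton`, Shalika inline);
* **`n6nsDyadic_of_cleanSgn_of_cleanSgn₂ (hβ) (hβ₂) : N6nsDyadicStatement`** — the registered row's TYPE from EXACTLY the two open tier-0 letters (`hβ` = tier-0 :211–212
  VERBATIM, `hβ₂` = tier-0 :231–260 VERBATIM): `:= n6nsDyadic_of_dyRamCore (dyRamCore_of_cleanSgn_of_cleanSgn₂ hβ hβ₂)`.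
USE (heir LEAD rules 57 ∕ 69; the MECHANICAL TAIL «tier-0 ED. 10 → LHD ED. 5 → AGG ED. 47» collapses to ONE pay edition): the minute (β) `…CleanSgnOfRecord.cleanSgn_ofRecord` and
(β₂) `…CleanSgnDiffTypeTwoOfRecord.cleanSgnDiffTypeTwo_ofRecord` are ★ `Theorems` constants, the CLOSED twin `Theorems/F0P3cN6nsDyadic.lean :: n6nsDyadic :
N6nsDyadicStatement := n6nsDyadic_of_cleanSgn_of_cleanSgn₂ ‹β› ‹β₂›` is a three-line file and the aggregator's row reads `stub_N6nsDyadic := F0P3cN6nsDyadic.n6nsDyadic` with a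
`Theorems` import only — AGG ED. 47 no longer waits on LHD ED. 5 or tier-0 ED. 10 (which stay the pen's count bookkeeping, written in any order).

HONEST LABEL: count-neutral — this file closes NOTHING by itself (its two hypotheses ARE the two open tier-0 letters; `stub_N6nsDyadic`, `stub_DyRamCore`, books and registries
untouched); h413 OPEN (verdict of record PRINT ∕ XL); HC_CM is proved only modulo the 7 printed citations (2 remaining named inputs: hLiu418 = `stmt-HodgeConjecture-24832`,
h413 = `stmt-HodgeConjecture-24833`) until rung 0 closes.

## References
* [Rogawski1990] J. D. Rogawski, *Automorphic Representations of Unitary Groups in Three Variables*, Ann. of Math. Stud. 123 (1990): §4.9 Prop. 4.9.1 (a) p. 55; §8.1 Prop. 8.1.1 p. 112.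
* [LanglandsShelstad1989] R. P. Langlands, D. Shelstad, *Orbital integrals on forms of SL(3), II*, Canad. J. Math. 41 (1989) 480–507: Theorem (end of §2, p. 484).
* [LanglandsShelstad1990Descent] R. P. Langlands, D. Shelstad, *Descent for transfer factors*, The Grothendieck Festschrift II (1990), §2.1.
-/

set_option autoImplicit false
-- the mandated namespace repeats the single-problem summit's segment (`HodgeConjecture.HodgeConjecture`)
set_option linter.dupNamespace false

noncomputable section

namespace Summit.HodgeConjecture.HodgeConjecture.Cruxes.H413.F0P3cN6nsDyadicOfLetters

open MeasureTheory Measure NumberField IsDedekindDomain Topology Filter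
open Literature.NumberTheory.Automorphic Literature.NumberTheory.Automorphic.UnitaryGroup Literature.NumberTheory.Automorphic.IntegralReduction
open Literature.NumberTheory.Rogawski1990 Literature.NumberTheory.GaloisRepresentations
open scoped Matrix MatrixGroups Classical ValuativeRel
open scoped WithZero
open Literature.NumberTheory.Automorphic.UnitaryThreeFourFrame
open Literature.NumberTheory.Automorphic.UnitaryLatticeTree Literature.NumberTheory.Automorphic.HermitianLattice
open Summit.HodgeConjecture.HodgeConjecture.Cruxes.H413.F0P3cDyRamFourFramePieces
open Summit.HodgeConjecture.HodgeConjecture.Cruxes.H413.F0P3cDyRamFourFrameLawDefs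
open Summit.HodgeConjecture.HodgeConjecture.Cruxes.H413.F0P3cDyRamFourFrameLawDefsR
open Summit.HodgeConjecture.HodgeConjecture.Cruxes.H413.F0P3cDyRamFourFrameLawDefsR2
open Summit.HodgeConjecture.HodgeConjecture.Cruxes.H413.F0P3cDyRamOmegaRDefs
open Summit.HodgeConjecture.HodgeConjecture.Cruxes.H413.F0P3cDyRamStageOneBDefs
open Summit.HodgeConjecture.HodgeConjecture.Cruxes.H413.F0P3cDyRamStageOneBDerivedDefs
open Summit.HodgeConjecture.HodgeConjecture.Cruxes.H413.F0P3cDyRamFourFrameHSideDefs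
open Summit.HodgeConjecture.HodgeConjecture.Cruxes.H413.F0P3cDyRamFourFrameHSideDefsR
open Summit.HodgeConjecture.HodgeConjecture.Cruxes.H413.F0P3cDyRamFourFrameHFamilyDefs
open Summit.HodgeConjecture.HodgeConjecture.Cruxes.H413.F0P3cDyRamFourFrameCensusDefs

set_option maxHeartbeats 800000 in
-- statement-heavy: the organ text is letter-sized
/-- **«DYADIC» from the ONE open organ (D-RAM)** — the dyadic leaf's head `n6nsDyadic_of_organs` with (D-SH) ∕ (D-UNR) discharged by name: `hram` = the organ text of
`stub_DyRamCore` VERBATIM (leaf ED. 4 :147–:170 = tier-0 `DyRamCore_of` :357–:378 = ★ p862417's conclusion; type digit of record 4239658620).  Proof = the leaf's (★ p847670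
pattern): ★ `n6nsDyadic_of_dyadicAntidiag`; `Subsingleton (PlacesOver L v)` from `c • w = w`; the Shalika expansion (D-SH) = ★ `UnitaryGroup.shalikaGermExpansionNonsplit_antidiagOne_three`;
the inert ∕ ramified dichotomy dispatches to ★ `F0P3cDyUnramCore.dyUnramCore` ∕ `hram`.
[cite: Rogawski1990, §4.9 Prop. 4.9.1 (a) p. 55] [cite: LanglandsShelstad1990Descent, §2.1 (2.1.2)] -/
theorem n6nsDyadic_of_dyRamCore
    (hram :
    ∀ (L : Type) [Field L] [NumberField L] [IsCMField L] (μ : HeckeCharacter L)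
      {v : HeightOneSpectrum (𝓞 ↥(maximalRealSubfield L))} (w : UnitaryGroup.PlacesOver L v)
      (_hw : IsCMField.complexConj L • w.1 = w.1) (_he : v.asIdeal.ramificationIdx' w.1.asIdeal ≠ 1)
      (_hμu : μ.IsUnitary)
      (_hμω : ∀ x : ideleGroup ↥(maximalRealSubfield L), μ (AdeleRing.ideleBaseChange ↥(maximalRealSubfield L) L x) = quadraticHeckeCharCM L x)
      (_h2 : ¬ IsUnit (2 : 𝒪[w.1.adicCompletion L]))
      [MeasurableSpace ((UnitaryGroup.cmDatum L 3 (Matrix.of fun i j : Fin 3 => if i.val + j.val + 1 = 3 then (1 : L) else 0)).Local v)] [BorelSpace ((UnitaryGroup.cmDatum L 3 (Matrix.of fun i j : Fin 3 => if i.val + j.val + 1 = 3 then (1 : L) else 0)).Local v)]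
      [∀ γ : ((UnitaryGroup.cmDatum L 3 (Matrix.of fun i j : Fin 3 => if i.val + j.val + 1 = 3 then (1 : L) else 0)).Local v), MeasurableSpace (((UnitaryGroup.cmDatum L 3 (Matrix.of fun i j : Fin 3 => if i.val + j.val + 1 = 3 then (1 : L) else 0)).Local v) ⧸ Subgroup.centralizer ({γ} : Set ((UnitaryGroup.cmDatum L 3 (Matrix.of fun i j : Fin 3 => if i.val + j.val + 1 = 3 then (1 : L) else 0)).Local v)))]
      [∀ γ : ((UnitaryGroup.cmDatum L 3 (Matrix.of fun i j : Fin 3 => if i.val + j.val + 1 = 3 then (1 : L) else 0)).Local v), BorelSpace (((UnitaryGroup.cmDatum L 3 (Matrix.of fun i j : Fin 3 => if i.val + j.val + 1 = 3 then (1 : L) else 0)).Local v) ⧸ Subgroup.centralizer ({γ} : Set ((UnitaryGroup.cmDatum L 3 (Matrix.of fun i j : Fin 3 => if i.val + j.val + 1 = 3 then (1 : L) else 0)).Local v)))]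
      [MeasurableSpace ((UnitaryGroup.cmDatum L 2 (Matrix.of fun i j : Fin 2 => if i.val + j.val + 1 = 2 then (1 : L) else 0)).Local v × (UnitaryGroup.cmDatum L 1 (Matrix.of fun i j : Fin 1 => if i.val + j.val + 1 = 1 then (1 : L) else 0)).Local v)] [BorelSpace ((UnitaryGroup.cmDatum L 2 (Matrix.of fun i j : Fin 2 => if i.val + j.val + 1 = 2 then (1 : L) else 0)).Local v × (UnitaryGroup.cmDatum L 1 (Matrix.of fun i j : Fin 1 => if i.val + j.val + 1 = 1 then (1 : L) else 0)).Local v)]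
      [∀ a : ((UnitaryGroup.cmDatum L 2 (Matrix.of fun i j : Fin 2 => if i.val + j.val + 1 = 2 then (1 : L) else 0)).Local v × (UnitaryGroup.cmDatum L 1 (Matrix.of fun i j : Fin 1 => if i.val + j.val + 1 = 1 then (1 : L) else 0)).Local v), MeasurableSpace (((UnitaryGroup.cmDatum L 2 (Matrix.of fun i j : Fin 2 => if i.val + j.val + 1 = 2 then (1 : L) else 0)).Local v × (UnitaryGroup.cmDatum L 1 (Matrix.of fun i j : Fin 1 => if i.val + j.val + 1 = 1 then (1 : L) else 0)).Local v) ⧸ Subgroup.centralizer ({a} : Set ((UnitaryGroup.cmDatum L 2 (Matrix.of fun i j : Fin 2 => if i.val + j.val + 1 = 2 then (1 : L) else 0)).Local v × (UnitaryGroup.cmDatum L 1 (Matrix.of fun i j : Fin 1 => if i.val + j.val + 1 = 1 then (1 : L) else 0)).Local v)))]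
      [∀ a : ((UnitaryGroup.cmDatum L 2 (Matrix.of fun i j : Fin 2 => if i.val + j.val + 1 = 2 then (1 : L) else 0)).Local v × (UnitaryGroup.cmDatum L 1 (Matrix.of fun i j : Fin 1 => if i.val + j.val + 1 = 1 then (1 : L) else 0)).Local v), BorelSpace (((UnitaryGroup.cmDatum L 2 (Matrix.of fun i j : Fin 2 => if i.val + j.val + 1 = 2 then (1 : L) else 0)).Local v × (UnitaryGroup.cmDatum L 1 (Matrix.of fun i j : Fin 1 => if i.val + j.val + 1 = 1 then (1 : L) else 0)).Local v) ⧸ Subgroup.centralizer ({a} : Set ((UnitaryGroup.cmDatum L 2 (Matrix.of fun i j : Fin 2 => if i.val + j.val + 1 = 2 then (1 : L) else 0)).Local v × (UnitaryGroup.cmDatum L 1 (Matrix.of fun i j : Fin 1 => if i.val + j.val + 1 = 1 then (1 : L) else 0)).Local v)))]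
      (νH : Measure ((UnitaryGroup.cmDatum L 2 (Matrix.of fun i j : Fin 2 => if i.val + j.val + 1 = 2 then (1 : L) else 0)).Local v × (UnitaryGroup.cmDatum L 1 (Matrix.of fun i j : Fin 1 => if i.val + j.val + 1 = 1 then (1 : L) else 0)).Local v)) [νH.IsHaarMeasure] [νH.IsMulRightInvariant]
      (νG₃ : Measure ((UnitaryGroup.cmDatum L 3 (Matrix.of fun i j : Fin 3 => if i.val + j.val + 1 = 3 then (1 : L) else 0)).Local v)) [νG₃.IsHaarMeasure] [νG₃.IsMulRightInvariant]
      {mH : OrbitalMeasureFamily ((UnitaryGroup.cmDatum L 2 (Matrix.of fun i j : Fin 2 => if i.val + j.val + 1 = 2 then (1 : L) else 0)).Local v × (UnitaryGroup.cmDatum L 1 (Matrix.of fun i j : Fin 1 => if i.val + j.val + 1 = 1 then (1 : L) else 0)).Local v)} {mG₃ : OrbitalMeasureFamily ((UnitaryGroup.cmDatum L 3 (Matrix.of fun i j : Fin 3 => if i.val + j.val + 1 = 3 then (1 : L) else 0)).Local v)},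
      mH.IsCanonical (IsLocalGRegular L v) νH → mG₃.IsCanonical (fun γ => IsRegularElt (γ.val : GL (Fin 3) (UnitaryGroup.LocalRing L v))) νG₃ →
      ShalikaGermExpansionNonsplit L (Matrix.of fun i j : Fin 3 => if i.val + j.val + 1 = 3 then (1 : L) else 0) v →
      ∀ (φ₃ : ((UnitaryGroup.cmDatum L 3 (Matrix.of fun i j : Fin 3 => if i.val + j.val + 1 = 3 then (1 : L) else 0)).Local v) → ℂ), IsLocSmooth φ₃ →
        ∃ V ∈ 𝓝 (1 : ((UnitaryGroup.cmDatum L 2 (Matrix.of fun i j : Fin 2 => if i.val + j.val + 1 = 2 then (1 : L) else 0)).Local v × (UnitaryGroup.cmDatum L 1 (Matrix.of fun i j : Fin 1 => if i.val + j.val + 1 = 1 then (1 : L) else 0)).Local v)), ∃ φH : ((UnitaryGroup.cmDatum L 2 (Matrix.of fun i j : Fin 2 => if i.val + j.val + 1 = 2 then (1 : L) else 0)).Local v × (UnitaryGroup.cmDatum L 1 (Matrix.of fun i j : Fin 1 => if i.val + j.val + 1 = 1 then (1 : L) else 0)).Local v) → ℂ, IsLocSmooth φH ∧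
          ∀ γH ∈ V, IsLocalGRegular L v γH →
            stableOrbitalIntegralRel (IsLocalStablyConjH L v) mH φH γH =
              ∑ᶠ c : ConjClasses ((UnitaryGroup.cmDatum L 3 (Matrix.of fun i j : Fin 3 => if i.val + j.val + 1 = 3 then (1 : L) else 0)).Local v), ((finExplicitCollection L (Matrix.of fun i j : Fin 3 => if i.val + j.val + 1 = 3 then (1 : L) else 0) μ (finExplicitDelta_conj_left_all L (Matrix.of fun i j : Fin 3 => if i.val + j.val + 1 = 3 then (1 : L) else 0) μ) (finExplicitDelta_conj_right_all L (Matrix.of fun i j : Fin 3 => if i.val + j.val + 1 = 3 then (1 : L) else 0) μ)) v).Δ γH (Quotient.out c) * classOrbitalIntegral mG₃ φ₃ c) :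
    Literature.NumberTheory.Rogawski1990.N6nsDyadicStatement := by
  refine n6nsDyadic_of_dyadicAntidiag ?_
  intro L _ _ _ μ v w hw hμu hμω h2 _ _ _ _ _ _ _ _ νH _ _ νG₃ _ _ mH mG₃ hmH hmG₃ φ₃ hφ₃
  -- `v` is non-split: `w` is the only place above it
  have hsub : Subsingleton (UnitaryGroup.PlacesOver L v) :=
    UnitaryGroup.PlacesOver.subsingleton_of_smul_eq (IsCMField.complexConj L) (IsCMField.complexConj_ne_one L) w hw
  -- organ (D-SH) by name, at this place
  have hSh : ShalikaGermExpansionNonsplit L (Matrix.of fun i j : Fin 3 => if i.val + j.val + 1 = 3 then (1 : L) else 0) v :=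
    UnitaryGroup.shalikaGermExpansionNonsplit_antidiagOne_three L v w hsub
  -- inert ∕ ramified dichotomy at `v`
  by_cases hv : Algebra.IsUnramifiedIn (𝓞 L) v.asIdeal
  · exact Summit.HodgeConjecture.HodgeConjecture.Cruxes.H413.F0P3cDyUnramCore.dyUnramCore L μ w hw hv hμu hμω h2 νH νG₃ hmH hmG₃ hSh φ₃ hφ₃
  · exact hram L μ w hw (ramificationIdx'_ne_one_of_not_isUnramifiedIn_of_subsingleton L hsub w hv) hμu hμω h2 νH νG₃ hmH hmG₃ hSh φ₃ hφ₃

set_option maxHeartbeats 800000 in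
-- statement-heavy: the (β₂) letter is place-sized
/-- **THE HYPOTHESIS-FORM `Theorems` TWIN OF THE REGISTERED ROW `stub_N6nsDyadic`**: `Literature.NumberTheory.Rogawski1990.N6nsDyadicStatement` ([Rogawski1990 §4.9 Prop.
4.9.1 (a)] local `Δ‴_v`-transfer at the identity at every DYADIC non-split place of a CM extension, for a unitary Hecke character restricting to `ω_{L/L⁺}`) FROM EXACTLY THE
TWO OPEN TIER-0 LETTERS — `hβ` = `stub_law_cleanSgn` :211–212 VERBATIM ((β) clean sign census frame-constant), `hβ₂` = `stub_law_cleanSgn₂` :231–260 VERBATIM ((β₂) type-(2)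
clean-shell label balance, difference form).  `:= n6nsDyadic_of_dyRamCore (F0P3cDyRamCoreOfLetters.dyRamCore_of_cleanSgn_of_cleanSgn₂ hβ hβ₂)`.
[cite: Rogawski1990, §4.9 Prop. 4.9.1 (a) p. 55] [cite: LanglandsShelstad1989, Theorem (end of §2) p. 484] -/
theorem n6nsDyadic_of_cleanSgn_of_cleanSgn₂
    (hβ : ∀ {K : Type} [Field K] [Valued K ℤᵐ⁰] [CompleteSpace K] [Fintype (Valued.ResidueField K)] (σ : K →+* K) (ϖ : K) (d t : ℕ),
    DyadicFence (K := K) (CleanSgnFrameConstLawAt n0DerivedOfRecord mcOfRecord σ ϖ d t))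
    (hβ₂ :
      ∀ (L : Type) [Field L] [NumberField L] [IsCMField L]
        {v : HeightOneSpectrum (𝓞 ↥(maximalRealSubfield L))} (w : UnitaryGroup.PlacesOver L v)
        (hw : IsCMField.complexConj L • w.1 = w.1) (_he : v.asIdeal.ramificationIdx' w.1.asIdeal ≠ 1)
        (_h2 : ¬ IsUnit (2 : Valued.integer (w.1.adicCompletion L)))
        (ϖ : (w.1.adicCompletion L)) (_hϖ : Valued.v ϖ = WithZero.exp (-1 : ℤ)) (d tE : ℕ) (_hD : IsRamifiedQuadraticDatum (galAdicCompletionMap (L := L) (IsCMField.complexConj L) hw) ϖ d tE)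
        [Fintype (Valued.ResidueField (w.1.adicCompletion L))] (δ : (w.1.adicCompletion L)) (_hδ : (galAdicCompletionMap (L := L) (IsCMField.complexConj L) hw) δ = -δ) (_hδ0 : δ ≠ 0)
        (μ : HeckeCharacter L) (_hμu : μ.IsUnitary)
        (_hμω : ∀ x : ideleGroup ↥(maximalRealSubfield L), μ (AdeleRing.ideleBaseChange ↥(maximalRealSubfield L) L x) = quadraticHeckeCharCM L x)
        [MeasurableSpace ((UnitaryGroup.cmDatum L 3 (Matrix.of fun i j : Fin 3 => if i.val + j.val + 1 = 3 then (1 : L) else 0)).Local v)] [BorelSpace ((UnitaryGroup.cmDatum L 3 (Matrix.of fun i j : Fin 3 => if i.val + j.val + 1 = 3 then (1 : L) else 0)).Local v)]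
        [∀ γ : ((UnitaryGroup.cmDatum L 3 (Matrix.of fun i j : Fin 3 => if i.val + j.val + 1 = 3 then (1 : L) else 0)).Local v), MeasurableSpace (((UnitaryGroup.cmDatum L 3 (Matrix.of fun i j : Fin 3 => if i.val + j.val + 1 = 3 then (1 : L) else 0)).Local v) ⧸ Subgroup.centralizer ({γ} : Set ((UnitaryGroup.cmDatum L 3 (Matrix.of fun i j : Fin 3 => if i.val + j.val + 1 = 3 then (1 : L) else 0)).Local v)))]
        [∀ γ : ((UnitaryGroup.cmDatum L 3 (Matrix.of fun i j : Fin 3 => if i.val + j.val + 1 = 3 then (1 : L) else 0)).Local v), BorelSpace (((UnitaryGroup.cmDatum L 3 (Matrix.of fun i j : Fin 3 => if i.val + j.val + 1 = 3 then (1 : L) else 0)).Local v) ⧸ Subgroup.centralizer ({γ} : Set ((UnitaryGroup.cmDatum L 3 (Matrix.of fun i j : Fin 3 => if i.val + j.val + 1 = 3 then (1 : L) else 0)).Local v)))]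
        [MeasurableSpace ((UnitaryGroup.cmDatum L 2 (Matrix.of fun i j : Fin 2 => if i.val + j.val + 1 = 2 then (1 : L) else 0)).Local v × (UnitaryGroup.cmDatum L 1 (Matrix.of fun i j : Fin 1 => if i.val + j.val + 1 = 1 then (1 : L) else 0)).Local v)] [BorelSpace ((UnitaryGroup.cmDatum L 2 (Matrix.of fun i j : Fin 2 => if i.val + j.val + 1 = 2 then (1 : L) else 0)).Local v × (UnitaryGroup.cmDatum L 1 (Matrix.of fun i j : Fin 1 => if i.val + j.val + 1 = 1 then (1 : L) else 0)).Local v)]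
        [∀ a : ((UnitaryGroup.cmDatum L 2 (Matrix.of fun i j : Fin 2 => if i.val + j.val + 1 = 2 then (1 : L) else 0)).Local v × (UnitaryGroup.cmDatum L 1 (Matrix.of fun i j : Fin 1 => if i.val + j.val + 1 = 1 then (1 : L) else 0)).Local v), MeasurableSpace (((UnitaryGroup.cmDatum L 2 (Matrix.of fun i j : Fin 2 => if i.val + j.val + 1 = 2 then (1 : L) else 0)).Local v × (UnitaryGroup.cmDatum L 1 (Matrix.of fun i j : Fin 1 => if i.val + j.val + 1 = 1 then (1 : L) else 0)).Local v) ⧸ Subgroup.centralizer ({a} : Set ((UnitaryGroup.cmDatum L 2 (Matrix.of fun i j : Fin 2 => if i.val + j.val + 1 = 2 then (1 : L) else 0)).Local v × (UnitaryGroup.cmDatum L 1 (Matrix.of fun i j : Fin 1 => if i.val + j.val + 1 = 1 then (1 : L) else 0)).Local v)))]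
        [∀ a : ((UnitaryGroup.cmDatum L 2 (Matrix.of fun i j : Fin 2 => if i.val + j.val + 1 = 2 then (1 : L) else 0)).Local v × (UnitaryGroup.cmDatum L 1 (Matrix.of fun i j : Fin 1 => if i.val + j.val + 1 = 1 then (1 : L) else 0)).Local v), BorelSpace (((UnitaryGroup.cmDatum L 2 (Matrix.of fun i j : Fin 2 => if i.val + j.val + 1 = 2 then (1 : L) else 0)).Local v × (UnitaryGroup.cmDatum L 1 (Matrix.of fun i j : Fin 1 => if i.val + j.val + 1 = 1 then (1 : L) else 0)).Local v) ⧸ Subgroup.centralizer ({a} : Set ((UnitaryGroup.cmDatum L 2 (Matrix.of fun i j : Fin 2 => if i.val + j.val + 1 = 2 then (1 : L) else 0)).Local v × (UnitaryGroup.cmDatum L 1 (Matrix.of fun i j : Fin 1 => if i.val + j.val + 1 = 1 then (1 : L) else 0)).Local v)))]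
        (νH : Measure ((UnitaryGroup.cmDatum L 2 (Matrix.of fun i j : Fin 2 => if i.val + j.val + 1 = 2 then (1 : L) else 0)).Local v × (UnitaryGroup.cmDatum L 1 (Matrix.of fun i j : Fin 1 => if i.val + j.val + 1 = 1 then (1 : L) else 0)).Local v)) [νH.IsHaarMeasure] [νH.IsMulRightInvariant]
        (νG₃ : Measure ((UnitaryGroup.cmDatum L 3 (Matrix.of fun i j : Fin 3 => if i.val + j.val + 1 = 3 then (1 : L) else 0)).Local v)) [νG₃.IsHaarMeasure] [νG₃.IsMulRightInvariant]
        (mH : OrbitalMeasureFamily ((UnitaryGroup.cmDatum L 2 (Matrix.of fun i j : Fin 2 => if i.val + j.val + 1 = 2 then (1 : L) else 0)).Local v × (UnitaryGroup.cmDatum L 1 (Matrix.of fun i j : Fin 1 => if i.val + j.val + 1 = 1 then (1 : L) else 0)).Local v)) (mG₃ : OrbitalMeasureFamily ((UnitaryGroup.cmDatum L 3 (Matrix.of fun i j : Fin 3 => if i.val + j.val + 1 = 3 then (1 : L) else 0)).Local v))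
        (_hmH : mH.IsCanonical (IsLocalGRegular L v) νH) (_hmG : mG₃.IsCanonical (fun γ => IsRegularElt (γ.val : GL (Fin 3) (UnitaryGroup.LocalRing L v))) νG₃),
                  (∃ V ∈ 𝓝 (1 : ((UnitaryGroup.cmDatum L 2 (Matrix.of fun i j : Fin 2 => if i.val + j.val + 1 = 2 then (1 : L) else 0)).Local v × (UnitaryGroup.cmDatum L 1 (Matrix.of fun i j : Fin 1 => if i.val + j.val + 1 = 1 then (1 : L) else 0)).Local v)), ∀ γH ∈ V, IsLocalGRegular L v γH →
      ¬ (∃ x : (w.1.adicCompletion L), (((((γH).1.val : GL (Fin 2) (UnitaryGroup.LocalRing L v)).val.map (Pi.evalRingHom (fun w' : UnitaryGroup.PlacesOver L v => w'.1.adicCompletion L) w))).charpoly).IsRoot x) →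
      ∀ δp δm : ((UnitaryGroup.cmDatum L 3 (Matrix.of fun i j : Fin 3 => if i.val + j.val + 1 = 3 then (1 : L) else 0)).Local v), IsLocalNormPair L (Matrix.of fun i j : Fin 3 => if i.val + j.val + 1 = 3 then (1 : L) else 0) v γH δp → finKappaAt L v (Matrix.of fun i j : Fin 3 => if i.val + j.val + 1 = 3 then (1 : L) else 0) γH δp = 1 → IsLocalNormPair L (Matrix.of fun i j : Fin 3 => if i.val + j.val + 1 = 3 then (1 : L) else 0) v γH δm → finKappaAt L v (Matrix.of fun i j : Fin 3 => if i.val + j.val + 1 = 3 then (1 : L) else 0) γH δm = -1 →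
        (transvPlusFixCount (galAdicCompletionMap (L := L) (IsCMField.complexConj L) hw) ϖ d (d % 2) (mstarOfRecord d) ((localNonsplitEquiv (IsCMField.complexConj L) (Matrix.of fun i j : Fin 3 => if i.val + j.val + 1 = 3 then (1 : L) else 0) (IsCMField.complexConj_ne_one L) w hw δp :
              ↥(unitaryGroupOfForm (galAdicCompletionMap (L := L) (IsCMField.complexConj L) hw) (placeForm (Matrix.of fun i j : Fin 3 => if i.val + j.val + 1 = 3 then (1 : L) else 0) w.1))) : GL (Fin 3) (w.1.adicCompletion L)) : ℤ) -
            (cleanMinusFixCount (galAdicCompletionMap (L := L) (IsCMField.complexConj L) hw) ϖ d (d % 2) (mstarOfRecord d) (mcOfRecord d) ((localNonsplitEquiv (IsCMField.complexConj L) (Matrix.of fun i j : Fin 3 => if i.val + j.val + 1 = 3 then (1 : L) else 0) (IsCMField.complexConj_ne_one L) w hw δp :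
              ↥(unitaryGroupOfForm (galAdicCompletionMap (L := L) (IsCMField.complexConj L) hw) (placeForm (Matrix.of fun i j : Fin 3 => if i.val + j.val + 1 = 3 then (1 : L) else 0) w.1))) : GL (Fin 3) (w.1.adicCompletion L)) : ℤ) =
          (transvPlusFixCount (galAdicCompletionMap (L := L) (IsCMField.complexConj L) hw) ϖ d (d % 2) (mstarOfRecord d) ((localNonsplitEquiv (IsCMField.complexConj L) (Matrix.of fun i j : Fin 3 => if i.val + j.val + 1 = 3 then (1 : L) else 0) (IsCMField.complexConj_ne_one L) w hw δm :
              ↥(unitaryGroupOfForm (galAdicCompletionMap (L := L) (IsCMField.complexConj L) hw) (placeForm (Matrix.of fun i j : Fin 3 => if i.val + j.val + 1 = 3 then (1 : L) else 0) w.1))) : GL (Fin 3) (w.1.adicCompletion L)) : ℤ) -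
            (cleanMinusFixCount (galAdicCompletionMap (L := L) (IsCMField.complexConj L) hw) ϖ d (d % 2) (mstarOfRecord d) (mcOfRecord d) ((localNonsplitEquiv (IsCMField.complexConj L) (Matrix.of fun i j : Fin 3 => if i.val + j.val + 1 = 3 then (1 : L) else 0) (IsCMField.complexConj_ne_one L) w hw δm :
              ↥(unitaryGroupOfForm (galAdicCompletionMap (L := L) (IsCMField.complexConj L) hw) (placeForm (Matrix.of fun i j : Fin 3 => if i.val + j.val + 1 = 3 then (1 : L) else 0) w.1))) : GL (Fin 3) (w.1.adicCompletion L)) : ℤ))) :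
    Literature.NumberTheory.Rogawski1990.N6nsDyadicStatement :=
  n6nsDyadic_of_dyRamCore (Summit.HodgeConjecture.HodgeConjecture.Cruxes.H413.F0P3cDyRamCoreOfLetters.dyRamCore_of_cleanSgn_of_cleanSgn₂ hβ hβ₂)

end Summit.HodgeConjecture.HodgeConjecture.Cruxes.H413.F0P3cN6nsDyadicOfLetters

end
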